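import Summits.QuantumFields.YangMills.Theorems.IR.ShellMaxCorrSupports

/-!
# Crux `IR` (item stmt-QuantumFields-19354) — line «maximal correlation at one physical thickness», collar E-seam:
NESTED-COLLAR SUBMULTIPLICATIVITY

Helper module for item `stmt-QuantumFields-19354` (`--supports … --as helper`; it closes nothing; lead prover
ym-ir-line-mxc-p1).  Core of the registered stub `CollarDecoupling.stub_collarCriterion : CollarCriterion`
(`Theorems/IR/ShellMaxCorrDefs.lean` §0, the E-seam of ideator ym-ir-idea-5's `collar-decoupling`, merged into the line by
director-ym R363 / crit-2).

* §1 Cauchy–Schwarz for bounded measurable real functions on a finite measure space, squared form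
  `(∫ u v)² ≤ (∫ u²)(∫ v²)` (`sq_integral_mul_le`, discriminant of `λ ↦ ∫ (λu + v)² ≥ 0`, Mathlib `discrim_le_zero`).
* §2 covariance bookkeeping in the explicit form used by `CollarDecouplingAt`: `∫ f g − ∫ f ∫ g = ∫ (f − ∫f)(g − ∫g)`,
  `(∫ f g − ∫ f ∫ g)² ≤ V(f) V(g)` with `V(f) = ∫ (f − ∫ f)²`, `V(f) ≤ 4 C_f²`.
* §3 `sq_corr_le_of_collar` — under `CollarDecouplingAt ρ β b`, for `g` exterior-local to every cube `Λ_{R'}(0)` with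
  `R' + M < t ≤ S` and `f` cube-local at radius `R` with `k (b+2) ≤ t − M − R`:
  `(∫ f g − ∫ f ∫ g)² ≤ 4^{-k} V(f) V(g)`.  Induction on `k`: the surrogate `f'` of the format has the same mean (test
  `h ≡ 1`) and the same pairing with `g` (test `h = g`, exterior-local at radius `R + b`), lives at radius `R + b + 2`, and
  `V(f') ≤ ¼ V(f)`.

Pure `L²` bookkeeping; no Yang–Mills input beyond the format; constants uniform in `β, b, S`.  HONEST FRAMING: toward ONE
stub of a CONDITIONAL rung line; no mass-gap claim.
-/

set_option autoImplicit false

noncomputable section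

open Filter Topology MeasureTheory ProbabilityTheory
open Literature.MathematicalPhysics.QuantumFieldTheory Literature.MathematicalPhysics.QuantumLattice
open Literature.Probability.LatticeModels (Torus.proj)
open Summit.QuantumFields.YangMills.Cruxes.IR.ShellMaxCorr (sub_natAbs_le_natAbs_valMinAbs abs_integral_le_of_abs_le)

namespace Summit.QuantumFields.YangMills.Cruxes.IR.CollarDecoupling

/-! ## §1 Cauchy–Schwarz for bounded observables (discriminant form, squared) -/

section CS

variable {Ω : Type*} [MeasurableSpace Ω] (μ : Measure Ω) [IsFiniteMeasure μ]

/-- **Cauchy–Schwarz, squared form**: `(∫ u v)² ≤ (∫ u²)(∫ v²)` for bounded measurable `u, v` (via the discriminant of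
`λ ↦ ∫ (λ u + v)² ≥ 0`). -/
theorem sq_integral_mul_le {u v : Ω → ℝ} (hu : Measurable u) (hv : Measurable v) {Cu Cv : ℝ}
    (hCu : ∀ ω, |u ω| ≤ Cu) (hCv : ∀ ω, |v ω| ≤ Cv) :
    (∫ ω, u ω * v ω ∂μ) ^ 2 ≤ (∫ ω, u ω ^ 2 ∂μ) * (∫ ω, v ω ^ 2 ∂μ) := by
  have hCu0 : ∀ ω, 0 ≤ Cu := fun ω => (abs_nonneg _).trans (hCu ω)
  have huu : Integrable (fun ω => u ω ^ 2) μ := by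
    refine integrable_of_ae_bdd_abs (hu.pow_const 2).aestronglyMeasurable (M := Cu ^ 2) (ae_of_all _ fun ω => ?_)
    rw [abs_pow]; exact pow_le_pow_left₀ (abs_nonneg _) (hCu ω) 2
  have hvv : Integrable (fun ω => v ω ^ 2) μ := by
    refine integrable_of_ae_bdd_abs (hv.pow_const 2).aestronglyMeasurable (M := Cv ^ 2) (ae_of_all _ fun ω => ?_)
    rw [abs_pow]; exact pow_le_pow_left₀ (abs_nonneg _) (hCv ω) 2
  have huv : Integrable (fun ω => u ω * v ω) μ := by
    refine integrable_of_ae_bdd_abs (hu.mul hv).aestronglyMeasurable (M := Cu * Cv) (ae_of_all _ fun ω => ?_)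
    rw [abs_mul]; exact mul_le_mul (hCu ω) (hCv ω) (abs_nonneg _) (hCu0 ω)
  have hquad : ∀ x : ℝ, 0 ≤ (∫ ω, u ω ^ 2 ∂μ) * (x * x) + (2 * ∫ ω, u ω * v ω ∂μ) * x + ∫ ω, v ω ^ 2 ∂μ := by
    intro x
    have hx : 0 ≤ ∫ ω, (x * u ω + v ω) ^ 2 ∂μ := integral_nonneg fun ω => sq_nonneg _
    have hexp : ∫ ω, (x * u ω + v ω) ^ 2 ∂μ =
        (∫ ω, u ω ^ 2 ∂μ) * (x * x) + (2 * ∫ ω, u ω * v ω ∂μ) * x + ∫ ω, v ω ^ 2 ∂μ := by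
      have hpt : (fun ω => (x * u ω + v ω) ^ 2) =
          fun ω => (x * x) * u ω ^ 2 + (2 * x) * (u ω * v ω) + v ω ^ 2 := by
        funext ω; ring
      have h1 : Integrable (fun ω => x * x * u ω ^ 2) μ := huu.const_mul (x * x)
      have h2 : Integrable (fun ω => 2 * x * (u ω * v ω)) μ := huv.const_mul (2 * x)
      have h12 : Integrable (fun ω => x * x * u ω ^ 2 + 2 * x * (u ω * v ω)) μ := h1.add h2
      rw [hpt, integral_add h12 hvv, integral_add h1 h2, integral_const_mul, integral_const_mul]
      ring
    rw [← hexp]; exact hx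
  have hd := discrim_le_zero hquad
  rw [discrim] at hd
  nlinarith [hd]

end CS

/-! ## §2 Covariance bookkeeping for cube-local statistics -/

section Cov

variable {G : Type} [MeasurableSpace G] {N : ℕ}

/-- `∫ f g − ∫ f ∫ g = ∫ (f − ∫ f)(g − ∫ g)` on a probability space, for bounded measurable `f, g`. -/
theorem corr_eq_integral_centred (μ : Measure (GaugeConfig 4 N G)) [IsProbabilityMeasure μ]
    {f g : GaugeConfig 4 N G → ℝ} (hf : Measurable f) (hg : Measurable g) {Cf Cg : ℝ}
    (hCf : ∀ U, |f U| ≤ Cf) (hCg : ∀ U, |g U| ≤ Cg) :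
    (∫ U, f U * g U ∂μ) - (∫ U, f U ∂μ) * (∫ U, g U ∂μ) =
      ∫ U, (f U - ∫ W, f W ∂μ) * (g U - ∫ W, g W ∂μ) ∂μ := by
  have hfi : Integrable f μ := integrable_of_ae_bdd_abs hf.aestronglyMeasurable (ae_of_all _ hCf)
  have hgi : Integrable g μ := integrable_of_ae_bdd_abs hg.aestronglyMeasurable (ae_of_all _ hCg)
  have hfg : Integrable (fun U => f U * g U) μ := by
    refine integrable_of_ae_bdd_abs (hf.mul hg).aestronglyMeasurable (M := Cf * Cg) (ae_of_all _ fun U => ?_)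
    rw [abs_mul]; exact mul_le_mul (hCf U) (hCg U) (abs_nonneg _) ((abs_nonneg _).trans (hCf U))
  set a := ∫ W, f W ∂μ
  set c := ∫ W, g W ∂μ
  have hpt : (fun U => (f U - a) * (g U - c)) = fun U => f U * g U - c * f U - a * g U + a * c := by
    funext U; ring
  have h1 : Integrable (fun U => c * f U) μ := hfi.const_mul c
  have h2 : Integrable (fun U => a * g U) μ := hgi.const_mul a
  have h3 : Integrable (fun U => f U * g U - c * f U) μ := hfg.sub h1
  have h4 : Integrable (fun U => f U * g U - c * f U - a * g U) μ := h3.sub h2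
  rw [hpt, integral_add h4 (integrable_const _), integral_sub h3 h2, integral_sub hfg h1,
    integral_const_mul, integral_const_mul, integral_const, probReal_univ, one_smul]
  ring

/-- The centred statistic `f − ∫ f` is bounded by `2 C_f`. -/
theorem abs_sub_integral_le (μ : Measure (GaugeConfig 4 N G)) [IsProbabilityMeasure μ]
    {f : GaugeConfig 4 N G → ℝ} {Cf : ℝ} (hCf : ∀ U, |f U| ≤ Cf) (U : GaugeConfig 4 N G) :
    |f U - ∫ W, f W ∂μ| ≤ 2 * Cf := by
  have h1 := abs_integral_le_of_abs_le μ hCf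
  calc |f U - ∫ W, f W ∂μ| ≤ |f U| + |∫ W, f W ∂μ| := abs_sub _ _
    _ ≤ Cf + Cf := add_le_add (hCf U) h1
    _ = 2 * Cf := by ring

/-- **Squared covariance bound**: `(∫ f g − ∫ f ∫ g)² ≤ V(f) V(g)` with `V(f) = ∫ (f − ∫ f)²`. -/
theorem sq_corr_le_var_mul_var (μ : Measure (GaugeConfig 4 N G)) [IsProbabilityMeasure μ]
    {f g : GaugeConfig 4 N G → ℝ} (hf : Measurable f) (hg : Measurable g) {Cf Cg : ℝ}
    (hCf : ∀ U, |f U| ≤ Cf) (hCg : ∀ U, |g U| ≤ Cg) :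
    ((∫ U, f U * g U ∂μ) - (∫ U, f U ∂μ) * (∫ U, g U ∂μ)) ^ 2 ≤
      (∫ U, (f U - ∫ W, f W ∂μ) ^ 2 ∂μ) * (∫ U, (g U - ∫ W, g W ∂μ) ^ 2 ∂μ) := by
  rw [corr_eq_integral_centred μ hf hg hCf hCg]
  exact sq_integral_mul_le μ (hf.sub_const _) (hg.sub_const _)
    (abs_sub_integral_le μ hCf) (abs_sub_integral_le μ hCg)

/-- `V(f) ≤ 4 C_f²`. -/
theorem var_le_sq (μ : Measure (GaugeConfig 4 N G)) [IsProbabilityMeasure μ]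
    {f : GaugeConfig 4 N G → ℝ} {Cf : ℝ} (hCf : ∀ U, |f U| ≤ Cf) :
    ∫ U, (f U - ∫ W, f W ∂μ) ^ 2 ∂μ ≤ (2 * Cf) ^ 2 := by
  have h := norm_integral_le_of_norm_le_const (μ := μ) (f := fun U => (f U - ∫ W, f W ∂μ) ^ 2)
    (C := (2 * Cf) ^ 2) (ae_of_all _ fun U => by
      rw [Real.norm_eq_abs, abs_pow]
      exact pow_le_pow_left₀ (abs_nonneg _) (abs_sub_integral_le μ hCf U) 2)
  rw [probReal_univ, mul_one, Real.norm_eq_abs] at h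
  exact (le_abs_self _).trans h

end Cov


/-! ## §3 Nested collars: the induction -/

section Nest

variable {G : Type} [Group G] [TopologicalSpace G] [IsTopologicalGroup G] [CompactSpace G]
  [MeasurableSpace G] [BorelSpace G]

omit [Group G] [TopologicalSpace G] [IsTopologicalGroup G] [CompactSpace G] [BorelSpace G] in
/-- Constant statistics are exterior-local (for every cube). -/
theorem isExteriorLocal_const (S : ℕ) (c : Site 4 (2 * S + 1)) (R : ℕ) (x : ℝ) :
    IsExteriorLocal (G := G) S c R (fun _ => x) :=
  ⟨measurable_const, ⟨|x|, fun _ => le_rfl⟩, (dependsOn_const x).mono (Set.empty_subset _)⟩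

/-- **Nested-collar submultiplicativity** (the heart of the E-seam).  Under `CollarDecouplingAt ρ β b`, on the torus of side
`2S+1`: if `g` is a bounded measurable statistic which is exterior-local for every cube `Λ_{R'}(0)` with `R' + M < t`
(`t ≤ S`), then for every cube-local `f` at radius `R` with `k (b+2) ≤ t − M − R`,
`(∫ f g − ∫ f ∫ g)² ≤ 4^{-k} · V(f) · V(g)` — each collar step swaps `f` for its surrogate (same mean, same pairing
with `g`) and quarters the variance. -/
theorem sq_corr_le_of_collar {n : ℕ} (ρ : G →* Matrix (Fin n) (Fin n) ℂ) (hρ : Continuous ρ) (β : ℝ) {b : ℕ}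
    (hP : CollarDecouplingAt ρ β b) (S : ℕ) {g : GaugeConfig 4 (2 * S + 1) G → ℝ} (hgm : Measurable g)
    {Cg : ℝ} (hgC : ∀ U, |g U| ≤ Cg) {M t : ℕ} (htS : t ≤ S)
    (hgext : ∀ R', R' + M < t → IsExteriorLocal S 0 R' g) :
    ∀ (k R : ℕ) (f : GaugeConfig 4 (2 * S + 1) G → ℝ), IsCubeLocal S 0 R f → k * (b + 2) ≤ t - M - R →
      ((∫ U, f U * g U ∂(wilsonMeasure (d := 4) (L := 2 * S + 1) ρ β)) -
          (∫ U, f U ∂(wilsonMeasure (d := 4) (L := 2 * S + 1) ρ β)) *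
            (∫ U, g U ∂(wilsonMeasure (d := 4) (L := 2 * S + 1) ρ β))) ^ 2 ≤
        (1 / 4 : ℝ) ^ k *
          (∫ U, (f U - ∫ W, f W ∂(wilsonMeasure (d := 4) (L := 2 * S + 1) ρ β)) ^ 2
              ∂(wilsonMeasure (d := 4) (L := 2 * S + 1) ρ β)) *
          (∫ U, (g U - ∫ W, g W ∂(wilsonMeasure (d := 4) (L := 2 * S + 1) ρ β)) ^ 2
              ∂(wilsonMeasure (d := 4) (L := 2 * S + 1) ρ β)) := by
  haveI : IsProbabilityMeasure (wilsonMeasure (d := 4) (L := 2 * S + 1) ρ β) :=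
    isProbabilityMeasure_wilsonMeasure (d := 4) (L := 2 * S + 1) ρ hρ β
  intro k
  induction k with
  | zero =>
    intro R f hf _
    obtain ⟨hfm, ⟨Cf, hfC⟩, -⟩ := hf
    rw [pow_zero, one_mul]
    exact sq_corr_le_var_mul_var _ hfm hgm hfC hgC
  | succ k ih =>
    intro R f hf hk
    obtain ⟨hfm, ⟨Cf, hfC⟩, -⟩ := id hf
    have hkpos : b + 2 ≤ t - M - R := le_trans (by nlinarith) hk
    have hroom : R + b + 2 ≤ S := by omega
    obtain ⟨f', hf', hswap, hvar⟩ := hP S 0 R hroom f hf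
    obtain ⟨hf'm, ⟨Cf', hf'C⟩, -⟩ := id hf'
    -- integrability
    have hfi : Integrable f (wilsonMeasure (d := 4) (L := 2 * S + 1) ρ β) := integrable_of_ae_bdd_abs hfm.aestronglyMeasurable (ae_of_all _ hfC)
    have hf'i : Integrable f' (wilsonMeasure (d := 4) (L := 2 * S + 1) ρ β) := integrable_of_ae_bdd_abs hf'm.aestronglyMeasurable (ae_of_all _ hf'C)
    have hfgi : Integrable (fun U => f U * g U) (wilsonMeasure (d := 4) (L := 2 * S + 1) ρ β) := by
      refine integrable_of_ae_bdd_abs (hfm.mul hgm).aestronglyMeasurable (M := Cf * Cg) (ae_of_all _ fun U => ?_)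
      rw [abs_mul]; exact mul_le_mul (hfC U) (hgC U) (abs_nonneg _) ((abs_nonneg _).trans (hfC U))
    have hf'gi : Integrable (fun U => f' U * g U) (wilsonMeasure (d := 4) (L := 2 * S + 1) ρ β) := by
      refine integrable_of_ae_bdd_abs (hf'm.mul hgm).aestronglyMeasurable (M := Cf' * Cg) (ae_of_all _ fun U => ?_)
      rw [abs_mul]; exact mul_le_mul (hf'C U) (hgC U) (abs_nonneg _) ((abs_nonneg _).trans (hf'C U))
    -- same mean
    have hmean : ∫ U, f' U ∂(wilsonMeasure (d := 4) (L := 2 * S + 1) ρ β) =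
        ∫ U, f U ∂(wilsonMeasure (d := 4) (L := 2 * S + 1) ρ β) := by
      have h := hswap (fun _ => (1 : ℝ)) (isExteriorLocal_const S 0 (R + b) 1)
      simp only [mul_one] at h
      rw [integral_sub hfi hf'i] at h
      linarith
    -- same pairing with `g`
    have hpair : ∫ U, f' U * g U ∂(wilsonMeasure (d := 4) (L := 2 * S + 1) ρ β) =
        ∫ U, f U * g U ∂(wilsonMeasure (d := 4) (L := 2 * S + 1) ρ β) := by
      have h := hswap g (hgext (R + b) (by omega))
      have hpt : (fun U => (f U - f' U) * g U) = fun U => f U * g U - f' U * g U := by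
        funext U; ring
      rw [hpt, integral_sub hfgi hf'gi] at h
      linarith
    -- induction hypothesis for the surrogate
    have hih := ih (R + b + 2) f' hf' (by
      have : (k + 1) * (b + 2) = k * (b + 2) + (b + 2) := by ring
      omega)
    rw [hmean, hpair] at hih
    refine hih.trans ?_
    have hVg : 0 ≤ ∫ U, (g U - ∫ W, g W ∂(wilsonMeasure (d := 4) (L := 2 * S + 1) ρ β)) ^ 2
        ∂(wilsonMeasure (d := 4) (L := 2 * S + 1) ρ β) := integral_nonneg fun U => sq_nonneg _
    have hq : 0 ≤ (1 / 4 : ℝ) ^ k := pow_nonneg (by norm_num) _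
    calc (1 / 4 : ℝ) ^ k *
          (∫ U, (f' U - ∫ W, f W ∂(wilsonMeasure (d := 4) (L := 2 * S + 1) ρ β)) ^ 2
              ∂(wilsonMeasure (d := 4) (L := 2 * S + 1) ρ β)) *
          (∫ U, (g U - ∫ W, g W ∂(wilsonMeasure (d := 4) (L := 2 * S + 1) ρ β)) ^ 2
              ∂(wilsonMeasure (d := 4) (L := 2 * S + 1) ρ β))
        ≤ (1 / 4 : ℝ) ^ k *
          ((1 / 4) * ∫ U, (f U - ∫ W, f W ∂(wilsonMeasure (d := 4) (L := 2 * S + 1) ρ β)) ^ 2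
              ∂(wilsonMeasure (d := 4) (L := 2 * S + 1) ρ β)) *
          (∫ U, (g U - ∫ W, g W ∂(wilsonMeasure (d := 4) (L := 2 * S + 1) ρ β)) ^ 2
              ∂(wilsonMeasure (d := 4) (L := 2 * S + 1) ρ β)) := by
          gcongr
      _ = (1 / 4 : ℝ) ^ (k + 1) *
          (∫ U, (f U - ∫ W, f W ∂(wilsonMeasure (d := 4) (L := 2 * S + 1) ρ β)) ^ 2
              ∂(wilsonMeasure (d := 4) (L := 2 * S + 1) ρ β)) *
          (∫ U, (g U - ∫ W, g W ∂(wilsonMeasure (d := 4) (L := 2 * S + 1) ρ β)) ^ 2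
              ∂(wilsonMeasure (d := 4) (L := 2 * S + 1) ρ β)) := by ring

end Nest


end Summit.QuantumFields.YangMills.Cruxes.IR.CollarDecoupling

end
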